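import Literature.AlgebraicTopology.SingularHomology.CechSingular
import Literature.AlgebraicTopology.SingularHomology.SubsetCohomologyContractible
import Literature.AlgebraicTopology.SingularHomology.UniversalCoefficientsField
import HarnessLib

/-!
# Bridges for the Čech–singular comparison: concrete cohomology versus the tree's singular cohomology

`Literature.AlgebraicTopology.SingularHomology.CechSingular` compares, for a family of subsets
`𝔘`, the CONCRETE cohomology `NatCochain.Cohomology` of the `𝔘`-small cochains with that of the
Čech complex of `0`-cocycles, under an elementwise acyclicity hypothesis on the finite
intersections. This file connects the three ends of that statement to the categorical objects
of the tree (A. Hatcher, *Algebraic Topology* (2002), §2.1 Prop. 2.21, §3.1 Thm. 3.2):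

* `natCohomologyEquivHomology` — for a complex `K` of `R`-modules indexed by `ℕ` (any shape with
  `next n = n + 1`), the concrete `NatCochain.Cohomology (fun n ↦ (K.d n (n+1)).hom) n` is
  linearly isomorphic to Mathlib's `K.homology n` (through the tree's homology classes
  `homologyCls`);
* `exists_cod_eq_of_isZero_homology`, **`exists_cod_eq_of_contractibleSpace`** — the acyclicity
  hypothesis of `cechSingular_colExact` for a subset `W` whose underlying space is contractible
  (coefficients `ULift R`, the tree's `subsetCochains.isZero_homology_of_contractibleSpace`);
* **`nonempty_smallCochainCohomology_equiv_singularCohomology`** — for an OPEN COVER `𝔘` of `X`,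
  `Hⁿ(Hom(C^𝔘, ULift R)) ≃ₗ[R] Hⁿ(X; R)` (`singularCohomology R R X n`): the concrete complex is the
  dual of the small chains, the restriction from all cochains is a quasi-isomorphism (Hatcher
  Prop. 2.21, `isIso_homologyMap_incl_smallSub`, dualised by
  `isIso_homologyMap_dualMap_of_quasiIso`; the small chains are free,
  `free_smallChains`), and `H_X(univ) = H(X)`; hence, over a field,
  **`finrank_smallCochainCohomology_eq_bettiNumber`**: `dim Hⁿ(Hom(C^𝔘, ULift F)) = bₙ(X; F)`
  (universal coefficients, `finrank_singularCohomology_eq_bettiNumber_of_field`).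

No named facts; everything is proved.

## References

* A. Hatcher, *Algebraic Topology*, CUP 2002, §2.1 Prop. 2.21; §3.1 pp. 197–204, Thm. 3.2.
  [HatcherAT2002]
-/

noncomputable section

-- as in `SingularChainsConcrete` / `LocalHomology`: chains of the concrete complex are `Finsupp`s up
-- to unfolding of semireducible definitions
set_option backward.isDefEq.respectTransparency false

open CategoryTheory Literature.Algebra.Homology

universe u v w

namespace Literature.AlgebraicTopology.SingularHomology

variable {R : Type v} [CommRing R]

/-! ### Concrete `ℕ`-indexed cohomology of a complex of modules versus Mathlib's homology -/

section NatBridge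

variable {c : ComplexShape ℕ} (K : HomologicalComplex (ModuleCat.{w} R) c)

/-- The differentials `Kⁿ → Kⁿ⁺¹` of a complex of modules as linear maps (the input format of
`NatCochain.Cohomology`). [folklore] -/
def natD (n : ℕ) : K.X n →ₗ[R] K.X (n + 1) :=
  (K.d n (n + 1)).hom

/-- `natD` is the differential. [folklore] -/
theorem natD_apply (n : ℕ) (x : K.X n) : natD K n x = K.d n (n + 1) x :=
  rfl

/-- A concrete cocycle is a cycle in Mathlib's sense. [folklore] -/
theorem d_next_eq_zero_of_mem_cocycles (hnext : ∀ n, c.next n = n + 1) {n : ℕ} {z : K.X n}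
    (hz : z ∈ NatCochain.cocycles (natD K) n) : K.d n (c.next n) z = 0 :=
  (d_next_eq_zero_iff (hnext n) z).2 ((NatCochain.mem_cocycles_iff _).1 hz)

/-- **The homology class of a concrete cocycle**, as a linear map `Zⁿ → Hⁿ(K)` (the tree's
`homologyCls`). [folklore] -/
def cocyclesToHomology (hnext : ∀ n, c.next n = n + 1) (n : ℕ) :
    ↥(NatCochain.cocycles (natD K) n) →ₗ[R] K.homology n where
  toFun z := homologyCls z.1 (d_next_eq_zero_of_mem_cocycles K hnext z.2)
  map_add' z z' := homologyCls_add z.1 z'.1 _ _ _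
  map_smul' r z := by
    rw [RingHom.id_apply]
    exact homologyCls_smul r z.1 _ _

/-- The class map on a cocycle. [folklore] -/
theorem cocyclesToHomology_apply (hnext : ∀ n, c.next n = n + 1) (n : ℕ)
    (z : ↥(NatCochain.cocycles (natD K) n)) :
    cocyclesToHomology K hnext n z = homologyCls z.1 (d_next_eq_zero_of_mem_cocycles K hnext z.2) :=
  rfl

/-- A concrete coboundary has homology class `0`. [folklore] -/
theorem cocyclesToHomology_eq_zero_of_mem_coboundaries (hnext : ∀ n, c.next n = n + 1)
    (hprev : ∀ n, c.prev (n + 1) = n) {n : ℕ} (z : ↥(NatCochain.cocycles (natD K) n))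
    (hz : (z : K.X n) ∈ NatCochain.coboundaries (natD K) n) : cocyclesToHomology K hnext n z = 0 := by
  rw [cocyclesToHomology_apply]
  cases n with
  | zero =>
    rw [NatCochain.coboundaries_zero, Submodule.mem_bot] at hz
    rw [homologyCls_congr hz _ (by rw [map_zero]), homologyCls_zero]
  | succ n =>
    obtain ⟨y, hy⟩ := (NatCochain.mem_coboundaries_succ_iff _).1 hz
    rw [homologyCls_eq_zero_iff, exists_d_prev_eq_iff (hprev n)]
    exact ⟨y, hy⟩

/-- **The comparison map `Hⁿ_concrete(K) → Hⁿ(K)`.** [folklore] -/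
def natCohomologyToHomology (hnext : ∀ n, c.next n = n + 1) (hprev : ∀ n, c.prev (n + 1) = n)
    (n : ℕ) : NatCochain.Cohomology (natD K) n →ₗ[R] K.homology n :=
  Submodule.liftQ _ (cocyclesToHomology K hnext n) fun z hz ↦
    LinearMap.mem_ker.2 (cocyclesToHomology_eq_zero_of_mem_coboundaries K hnext hprev z hz)

/-- The comparison map on the class of a cocycle. [folklore] -/
theorem natCohomologyToHomology_mk (hnext : ∀ n, c.next n = n + 1)
    (hprev : ∀ n, c.prev (n + 1) = n) (n : ℕ) (z : ↥(NatCochain.cocycles (natD K) n)) :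
    natCohomologyToHomology K hnext hprev n (NatCochain.Cohomology.mk (natD K) n z) =
      homologyCls z.1 (d_next_eq_zero_of_mem_cocycles K hnext z.2) :=
  rfl

/-- A cycle whose class vanishes is a concrete coboundary. [folklore] -/
theorem mem_coboundaries_of_homologyCls_eq_zero (hnext : ∀ n, c.next n = n + 1)
    (hprev : ∀ n, c.prev (n + 1) = n) (h0 : ∀ i, ¬c.Rel i 0) {n : ℕ}
    (z : ↥(NatCochain.cocycles (natD K) n))
    (h : homologyCls z.1 (d_next_eq_zero_of_mem_cocycles K hnext z.2) = 0) :
    (z : K.X n) ∈ NatCochain.coboundaries (natD K) n := by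
  rw [homologyCls_eq_zero_iff] at h
  cases n with
  | zero =>
    obtain ⟨w, hw⟩ := h
    rw [K.shape _ _ (h0 _)] at hw
    rw [NatCochain.coboundaries_zero, Submodule.mem_bot, ← hw]
    rfl
  | succ n =>
    rw [exists_d_prev_eq_iff (hprev n)] at h
    exact (NatCochain.mem_coboundaries_succ_iff _).2 h

/-- **`Hⁿ_concrete(K) → Hⁿ(K)` is bijective.** [folklore] -/
theorem bijective_natCohomologyToHomology (hnext : ∀ n, c.next n = n + 1)
    (hprev : ∀ n, c.prev (n + 1) = n) (h0 : ∀ i, ¬c.Rel i 0) (n : ℕ) :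
    Function.Bijective (natCohomologyToHomology K hnext hprev n) := by
  constructor
  · rw [injective_iff_map_eq_zero]
    intro x hx
    obtain ⟨z, rfl⟩ := NatCochain.Cohomology.mk_surjective (natD K) n x
    rw [natCohomologyToHomology_mk] at hx
    exact (NatCochain.Cohomology.mk_eq_zero_iff (natD K) z).2
      (mem_coboundaries_of_homologyCls_eq_zero K hnext hprev h0 z hx)
  · intro y
    obtain ⟨z, hz, rfl⟩ := homologyCls_surjective y
    exact ⟨NatCochain.Cohomology.mk (natD K) n ⟨z, (NatCochain.mem_cocycles_iff _).2
      ((d_next_eq_zero_iff (hnext n) z).1 hz)⟩, rfl⟩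

/-- **The concrete `ℕ`-indexed cohomology of a complex of modules is Mathlib's homology**:
`NatCochain.Cohomology (fun n ↦ (K.d n (n+1)).hom) n ≃ₗ[R] K.homology n`. [folklore] -/
def natCohomologyEquivHomology (hnext : ∀ n, c.next n = n + 1) (hprev : ∀ n, c.prev (n + 1) = n)
    (h0 : ∀ i, ¬c.Rel i 0) (n : ℕ) : NatCochain.Cohomology (natD K) n ≃ₗ[R] K.homology n :=
  LinearEquiv.ofBijective _ (bijective_natCohomologyToHomology K hnext hprev h0 n)

end NatBridge

-- The shape identities `(down ℕ).symm.next n = n + 1` and `(down ℕ).symm.prev (n + 1) = n`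
-- are `(ComplexShape.down ℕ).symm.next_eq' rfl` / `.prev_eq' rfl` (also available as
-- `SimplexSpan.symm_down_next` / `symm_down_prev_succ` in `CechCapProduct.lean`, not imported
-- here to keep the import closure small); they are used inline below.

/-- Nothing precedes `0` in the shape `(down ℕ).symm`. [folklore] -/
theorem downSymm_not_rel_zero (i : ℕ) : ¬(ComplexShape.down ℕ).symm.Rel i 0 :=
  fun h ↦ Nat.succ_ne_zero i h

/-! ### The acyclicity hypothesis from vanishing of the cohomology of a subset -/

section Acyclic

variable {X : Type u} [TopologicalSpace X]

/-- **From `H^{q+1}_X(W; N) = 0` to the elementwise acyclicity of the concrete cochains of `W`**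
(the hypothesis `hacyc` of `cechSingular_colExact`): every concrete `(q+1)`-cocycle of `W` is a
coboundary. [folklore] -/
theorem exists_cod_eq_of_isZero_homology {N : Type (max u v)} [AddCommGroup N] [Module R N]
    (W : Set X) {q : ℕ}
    (h : Limits.IsZero ((subsetCochains R (ModuleCat.of R N) W).homology (q + 1)))
    (ψ : CochainOn R N W (q + 1)) (hψ : cod W (q + 1) ψ = 0) :
    ∃ φ : CochainOn R N W q, cod W q φ = ψ := by
  rw [isZero_homology_iff] at h
  have hz : (subsetCochains R (ModuleCat.of R N) W).d (q + 1)
      ((ComplexShape.down ℕ).symm.next (q + 1)) (ModuleCat.ofHom ψ) = 0 := by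
    rw [d_next_eq_zero_iff ((ComplexShape.down ℕ).symm.next_eq' rfl), dualObj_d_apply]
    apply ModuleCat.hom_ext
    rw [ModuleCat.hom_comp, ModuleCat.hom_ofHom, ModuleCat.hom_zero]
    exact hψ
  obtain ⟨w, hw⟩ := (exists_d_prev_eq_iff ((ComplexShape.down ℕ).symm.prev_eq' rfl) _).1 (h _ hz)
  refine ⟨w.hom, ?_⟩
  rw [dualObj_d_apply] at hw
  have hw' := congrArg (ModuleCat.Hom.hom (R := R)) hw
  rw [ModuleCat.hom_comp, ModuleCat.hom_ofHom] at hw'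
  exact hw'

/-- **Contractible subsets are acyclic for the concrete cochains** (coefficients `ULift R`): if
`↥W` is contractible, every concrete `(q+1)`-cocycle of `W` is a coboundary (Hatcher 2002, §3.1
p. 201; the tree's `subsetCochains.isZero_homology_of_contractibleSpace`).
[cite: HatcherAT2002, §3.1 p. 201] -/
theorem exists_cod_eq_of_contractibleSpace (W : Set X) [ContractibleSpace ↥W] {q : ℕ}
    (ψ : CochainOn R (ULift.{u} R) W (q + 1)) (hψ : cod W (q + 1) ψ = 0) :
    ∃ φ : CochainOn R (ULift.{u} R) W q, cod W q φ = ψ :=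
  exists_cod_eq_of_isZero_homology W
    (subsetCochains.isZero_homology_of_contractibleSpace R W (Nat.succ_ne_zero q)) ψ hψ

/-- The empty subset is acyclic for the concrete cochains (its chain modules vanish: no simplex
has image in `∅`). [folklore] -/
theorem exists_cod_eq_of_eq_empty {N : Type w} [AddCommGroup N] [Module R N] {W : Set X}
    (hW : W = ∅) {q : ℕ} (ψ : CochainOn R N W (q + 1)) :
    ∃ φ : CochainOn R N W q, cod W q φ = ψ := by
  refine ⟨0, ?_⟩
  rw [map_zero]
  refine (LinearMap.ext fun x ↦ ?_).symm
  have hx : x = 0 := by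
    apply Subtype.ext
    have h := (mem_chainsIn_iff R R _).1 x.2
    change (x.1 : CChain R X (q + 1)) = 0
    refine Finsupp.ext fun σ ↦ ?_
    by_contra hσ
    have hne := (SingularSimplex.range_nonempty σ).ne_empty
    exact hne (Set.subset_empty_iff.1 (hW ▸ h σ (Finsupp.mem_support_iff.2 hσ)))
  rw [hx, map_zero, LinearMap.zero_apply]

end Acyclic

/-! ### Small cochains compute the singular cohomology of `X` -/

section Small

variable {X : Type u} [TopologicalSpace X] {ι : Type*} (U : ι → Set X)

/-- **The module of `𝔘`-small chains is free** (on the small simplices: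
`Σ_i C(U_i) = ` the `Finsupp.supported` submodule on `⋃_i {σ ⊆ U_i}`). [cite: HatcherAT2002, §2.1] -/
theorem free_smallChains (n : ℕ) : Module.Free R ↥(smallChains R R X U n) := by
  have h : smallChains R R X U n = Finsupp.supported R R (⋃ i, simplicesIn X (U i) n) := by
    rw [smallChains, Finsupp.supported_iUnion]
    rfl
  rw [h]
  exact free_supported R _

/-- The chain modules of `C^𝔘` are projective objects of `ModuleCat R`. [folklore] -/
instance projective_smallSub_X (n : ℕ) : Projective ((smallSub R R X U).toComplex.X n) := by
  haveI : Module.Free R ↥(smallChains R R X U n) := free_smallChains U n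
  haveI : Module.Projective R ↥(smallChains R R X U n) := Module.Projective.of_free
  exact ModuleCat.projective_of_categoryTheory_projective (ModuleCat.of R ↥(smallChains R R X U n))

variable {N : Type (max u v)} [AddCommGroup N] [Module R N]

/-- The concrete small-cochain complex is the dual `Hom(C^𝔘, N)` of the small chains: the
comparison `a ↦ ModuleCat.ofHom a` in each degree. [folklore] -/
def smallCochainToDual (q : ℕ) :
    SmallCochain R N U q →ₗ[R] (dualObj R (ModuleCat.of R N) (smallSub R R X U).toComplex).X q where
  toFun a := ModuleCat.ofHom a
  map_add' _ _ := by
    apply ModuleCat.hom_ext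
    rfl
  map_smul' _ _ := by
    apply ModuleCat.hom_ext
    rfl

/-- The comparison is `ModuleCat.ofHom`. [folklore] -/
theorem smallCochainToDual_apply (q : ℕ) (a : SmallCochain R N U q) :
    smallCochainToDual U q a = ModuleCat.ofHom a :=
  rfl

/-- The comparison is a cochain map. [folklore] -/
theorem smallCochainToDual_comm (q : ℕ) (a : SmallCochain R N U q) :
    smallCochainToDual U (q + 1) ((cechSingularRow R N U).dA q a) =
      natD (dualObj R (ModuleCat.of R N) (smallSub R R X U).toComplex) q (smallCochainToDual U q a) := by
  rw [smallCochainToDual_apply, smallCochainToDual_apply, natD_apply, dualObj_d_apply]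
  apply ModuleCat.hom_ext
  rw [ModuleCat.hom_ofHom, ModuleCat.hom_comp, ModuleCat.hom_ofHom]
  rfl

/-- The comparison is bijective in each degree. [folklore] -/
theorem bijective_smallCochainToDual (q : ℕ) : Function.Bijective (smallCochainToDual (R := R) (N := N) U q) :=
  ⟨fun a b h ↦ by
    have h' := congrArg (ModuleCat.Hom.hom (R := R)) h
    rwa [smallCochainToDual_apply, smallCochainToDual_apply, ModuleCat.hom_ofHom,
      ModuleCat.hom_ofHom] at h',
   fun f ↦ ⟨f.hom, by rw [smallCochainToDual_apply, ModuleCat.ofHom_hom]⟩⟩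

/-- **The concrete cohomology of the small cochains is the cohomology of `Hom(C^𝔘, N)`.**
[folklore] -/
def smallCochainCohomologyEquivDual (n : ℕ) :
    NatCochain.Cohomology (cechSingularRow R N U).dA n ≃ₗ[R]
      (dualObj R (ModuleCat.of R N) (smallSub R R X U).toComplex).homology n :=
  (NatCochain.Cohomology.equivOfBijective (smallCochainToDual U) (smallCochainToDual_comm U)
    (bijective_smallCochainToDual U) n).trans
    (natCohomologyEquivHomology _ (fun _ ↦ (ComplexShape.down ℕ).symm.next_eq' rfl)
      (fun _ ↦ (ComplexShape.down ℕ).symm.prev_eq' rfl) downSymm_not_rel_zero n)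

/-- **Restriction to small cochains is an isomorphism on cohomology** for an open cover
(Hatcher 2002, Prop. 2.21 dualised, §3.1 p. 204: "the map `Cⁿ(X) → Cⁿ(A + B)` induces an
isomorphism on cohomology"). [cite: HatcherAT2002, §3.1 p. 204] -/
theorem isIso_homologyMap_dualMap_incl_smallSub (hU : ∀ i, IsOpen (U i))
    (hcov : (Set.univ : Set X) ⊆ ⋃ i, U i) (n : ℕ) :
    IsIso (HomologicalComplex.homologyMap (dualMap R (ModuleCat.of R N)
      (Subcomplex.incl (smallSub_le_chainsInSub R R (U := U) (Y := Set.univ)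
        fun _ ↦ Set.subset_univ _))) n) := by
  haveI : QuasiIso (Subcomplex.incl (smallSub_le_chainsInSub R R (U := U) (Y := Set.univ)
      fun _ ↦ Set.subset_univ _)) :=
    ⟨fun k ↦ by
      rw [quasiIsoAt_iff_isIso_homologyMap]
      exact isIso_homologyMap_incl_smallSub R R U hU (fun _ ↦ Set.subset_univ _) hcov k⟩
  exact isIso_homologyMap_dualMap_of_quasiIso _ n

/-- **The cohomology of `Hom(C^𝔘, N)` is the cohomology of `X` computed in `C(X)`** (`A = univ`),
for an open cover `𝔘`. [cite: HatcherAT2002, §3.1 p. 204] -/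
def dualSmallHomologyIso (hU : ∀ i, IsOpen (U i)) (hcov : (Set.univ : Set X) ⊆ ⋃ i, U i) (n : ℕ) :
    (subsetCochains R (ModuleCat.of R N) (Set.univ : Set X)).homology n ≅
      (dualObj R (ModuleCat.of R N) (smallSub R R X U).toComplex).homology n :=
  haveI := isIso_homologyMap_dualMap_incl_smallSub (R := R) (N := N) U hU hcov n
  asIso (HomologicalComplex.homologyMap (dualMap R (ModuleCat.of R N)
    (Subcomplex.incl (smallSub_le_chainsInSub R R (U := U) (Y := Set.univ)
      fun _ ↦ Set.subset_univ _))) n)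

/-- **Small cochains compute singular cohomology**: for an open cover `𝔘` of `X`,
`Hⁿ(Hom(C^𝔘, ULift R)) ≃ₗ[R] Hⁿ(X; R)` (`singularCohomology R R X n` of the tree; Hatcher 2002,
Prop. 2.21 and §3.1 p. 204). [cite: HatcherAT2002, §3.1 p. 204] -/
theorem nonempty_smallCochainCohomology_equiv_singularCohomology (hU : ∀ i, IsOpen (U i))
    (hcov : (Set.univ : Set X) ⊆ ⋃ i, U i) (n : ℕ) :
    Nonempty (NatCochain.Cohomology (cechSingularRow R (ULift.{u} R) U).dA n ≃ₗ[R]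
      singularCohomology R R X n) :=
  ⟨(smallCochainCohomologyEquivDual U n).trans
    (((dualSmallHomologyIso U hU hcov n).symm ≪≫
      subsetCochains.homologyIsoSingularCohomology R Set.univ n ≪≫
        (singularCohomology.mapIso (R := R) (M := R) (Homeomorph.Set.univ X) n).symm).toLinearEquiv)⟩

/-- **Over a field, the dimension of the small-cochain cohomology is the Betti number**:
`dim_F Hⁿ(Hom(C^𝔘, ULift F)) = bₙ(X; F)` for an open cover `𝔘` (universal coefficients,
Hatcher 2002, Thm. 3.2). [cite: HatcherAT2002, §3.1 Thm. 3.2] -/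
theorem finrank_smallCochainCohomology_eq_bettiNumber {F : Type v} [Field F]
    (hU : ∀ i, IsOpen (U i)) (hcov : (Set.univ : Set X) ⊆ ⋃ i, U i) (n : ℕ) :
    Module.finrank F (NatCochain.Cohomology (cechSingularRow F (ULift.{u} F) U).dA n) =
      bettiNumber F X n := by
  obtain ⟨e⟩ := nonempty_smallCochainCohomology_equiv_singularCohomology (R := F) U hU hcov n
  rw [e.finrank_eq]
  exact finrank_singularCohomology_eq_bettiNumber_of_field F X n

end Small

end Literature.AlgebraicTopology.SingularHomology
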